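import Summits.RiemannHypothesis.RiemannHypothesis.Theorems.WeilFormatCDataO97TabValid1B
import Summits.RiemannHypothesis.RiemannHypothesis.Theorems.WeilFormatCDataO97TabValid2BC
import Summits.RiemannHypothesis.RiemannHypothesis.Theorems.WeilFormatCDataO97TabValid3B
import Summits.RiemannHypothesis.RiemannHypothesis.Theorems.WeilFormatCDataO97TabValid4B
import Summits.RiemannHypothesis.RiemannHypothesis.Theorems.WeilFormatCDataO97TabValid5
import Summits.RiemannHypothesis.RiemannHypothesis.Theorems.WeilFormatCDataO97TabValid
import Summits.RiemannHypothesis.RiemannHypothesis.Theorems.WeilFormatCDataO97ColSlice0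
import Summits.RiemannHypothesis.RiemannHypothesis.Theorems.WeilFormatCDataO97ColSlice1
import Summits.RiemannHypothesis.RiemannHypothesis.Theorems.WeilFormatCDataO97ColSlice2
import Summits.RiemannHypothesis.RiemannHypothesis.Theorems.WeilFormatCDataO97ColSlice3
import Summits.RiemannHypothesis.RiemannHypothesis.Theorems.WeilFormatCDataO97ColSlice4
import Summits.RiemannHypothesis.RiemannHypothesis.Theorems.WeilFormatCDataO97ColSlice5
import Summits.RiemannHypothesis.RiemannHypothesis.Theorems.WeilFormatCDataO97ColSlice6
import Summits.RiemannHypothesis.RiemannHypothesis.Theorems.WeilFormatCDataO97ColSlice7B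
import Summits.RiemannHypothesis.RiemannHypothesis.Theorems.WeilFormatCDataO97ColSlice8
import Summits.RiemannHypothesis.RiemannHypothesis.Theorems.WeilFormatCDataO97ColSlice9B
import Summits.RiemannHypothesis.RiemannHypothesis.Theorems.WeilFormatCDataO97ColSlice10B
import Summits.RiemannHypothesis.RiemannHypothesis.Theorems.WeilFormatCDataO97ColSlice11B
import Summits.RiemannHypothesis.RiemannHypothesis.Theorems.WeilFormatCDataO97ColSlice12B
import Summits.RiemannHypothesis.RiemannHypothesis.Theorems.WeilFormatCDataO97ColSlice13B
import Summits.RiemannHypothesis.RiemannHypothesis.Theorems.WeilFormatCDataO97FrontB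
import Summits.RiemannHypothesis.RiemannHypothesis.Theorems.WeilFormatCDataO97FrontW1B
import Summits.RiemannHypothesis.RiemannHypothesis.Theorems.WeilFormatCDataO97FrontW2B
import Summits.RiemannHypothesis.RiemannHypothesis.Theorems.WeilFormatCDataO97FrontDataW
import Summits.RiemannHypothesis.RiemannHypothesis.Theorems.WeilFormatCDataA1RungCB
import Summits.RiemannHypothesis.RiemannHypothesis.Theorems.WeilFormatCDataO97Mid
import Summits.RiemannHypothesis.RiemannHypothesis.Theorems.WeilFormatCDataO97CBOddCols0
import Summits.RiemannHypothesis.RiemannHypothesis.Theorems.WeilFormatCDataO97CBOddCols1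
import Summits.RiemannHypothesis.RiemannHypothesis.Theorems.WeilFormatCDataO97CBOddCols2
import Summits.RiemannHypothesis.RiemannHypothesis.Theorems.WeilFormatCDataO97CBOddCols3
import Summits.RiemannHypothesis.RiemannHypothesis.Theorems.WeilFormatCDataO97CBOddCols4
import Summits.RiemannHypothesis.RiemannHypothesis.Theorems.WeilFormatCDataO97CBOddCols5
import Summits.RiemannHypothesis.RiemannHypothesis.Theorems.WeilFormatCDataO97CBOddCols6
import Summits.RiemannHypothesis.RiemannHypothesis.Theorems.WeilFormatCDataO97CBOddTailPsi0
import Summits.RiemannHypothesis.RiemannHypothesis.Theorems.WeilFormatCDataO97CBOddTail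
import Summits.RiemannHypothesis.RiemannHypothesis.Theorems.WeilFormatCDataO97CBOddSchur0
import Summits.RiemannHypothesis.RiemannHypothesis.Theorems.WeilFormatCDataO97CBOddSchur1
import Summits.RiemannHypothesis.RiemannHypothesis.Theorems.WeilFormatCDataO97CBOddSchur2
import Summits.RiemannHypothesis.RiemannHypothesis.Theorems.WeilFormatCDataO97CBOddSchur3
import Summits.RiemannHypothesis.RiemannHypothesis.Theorems.WeilFormatCDataO97CBOddSchur4
import Summits.RiemannHypothesis.RiemannHypothesis.Theorems.WeilFormatCDataO97CBOddSchur5B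
import Summits.RiemannHypothesis.RiemannHypothesis.Theorems.WeilFormatCDataO97CBOddSchur6B
import Summits.RiemannHypothesis.RiemannHypothesis.Theorems.WeilFormatCDataO97CBOddSchur7B
import Summits.RiemannHypothesis.RiemannHypothesis.Theorems.WeilFormatCDataO97CBOddSchur8B
import Summits.RiemannHypothesis.RiemannHypothesis.Theorems.WeilFormatCDataO97CBOddSchur9B
import Summits.RiemannHypothesis.RiemannHypothesis.Theorems.WeilFormatCDataO97CBOddSchur10B
import Summits.RiemannHypothesis.RiemannHypothesis.Theorems.WeilFormatCDataO97CBOddSchur11B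
import Summits.RiemannHypothesis.RiemannHypothesis.Theorems.WeilFormatCDataO97CBOddSchur12B
import Summits.RiemannHypothesis.RiemannHypothesis.Theorems.WeilFormatCDataO97CBOddSchur13B
import Summits.RiemannHypothesis.RiemannHypothesis.Theorems.WeilFormatCDataO97CBOddSchur14B
import Summits.RiemannHypothesis.RiemannHypothesis.Theorems.WeilFormatCDataO97CBOddSchur15B
import Summits.RiemannHypothesis.RiemannHypothesis.Theorems.WeilFormatCDataO97CBOddSchur16B
import Summits.RiemannHypothesis.RiemannHypothesis.Theorems.WeilFormatCDataO97CBOddSchur17B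
import Summits.RiemannHypothesis.RiemannHypothesis.Theorems.WeilFormatCDataO97CBOddSchur18B
import Summits.RiemannHypothesis.RiemannHypothesis.Theorems.WeilFormatCDataO97CBOddSchur19B
import Summits.RiemannHypothesis.RiemannHypothesis.Theorems.WeilFormatCDataO97CBOddSchur20B
import Summits.RiemannHypothesis.RiemannHypothesis.Theorems.WeilFormatCDataO97CBOddSchur21B
import Summits.RiemannHypothesis.RiemannHypothesis.Theorems.WeilFormatCDataO97CBOddSchur22B
import Summits.RiemannHypothesis.RiemannHypothesis.Theorems.WeilFormatCDataO97CBOddSchur23B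
import Summits.RiemannHypothesis.RiemannHypothesis.Theorems.WeilFormatCDataO97CBOddSchur24B
import Summits.RiemannHypothesis.RiemannHypothesis.Theorems.WeilFormatCDataO97CBOddSchur25B
import Summits.RiemannHypothesis.RiemannHypothesis.Theorems.WeilFormatCDataO97CBOddSchur26B
import Summits.RiemannHypothesis.RiemannHypothesis.Theorems.WeilFormatCDataO97CBOddSchur27B
import Summits.RiemannHypothesis.RiemannHypothesis.Theorems.WeilFormatCDataO97CBOddPsd0B
import Summits.RiemannHypothesis.RiemannHypothesis.Theorems.WeilFormatCDataO97CBOddPsd1B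
import Summits.RiemannHypothesis.RiemannHypothesis.Theorems.WeilFormatCDataO97CBOddPsd2B
import Summits.RiemannHypothesis.RiemannHypothesis.Theorems.WeilFormatCDataO97CBOddPsd3
import Summits.RiemannHypothesis.RiemannHypothesis.Theorems.WeilFormatCDataO97CBOddPsd4
import Summits.RiemannHypothesis.RiemannHypothesis.Theorems.WeilFormatCDataO97CBOddPsd5
import Summits.RiemannHypothesis.RiemannHypothesis.Theorems.S2FormatCE0
import Literature.NumberTheory.LFunctions.YoshidaWindowGramTailMSSines
import Literature.NumberTheory.LFunctions.YoshidaWindowGramMiddleJBox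
import Literature.NumberTheory.LFunctions.YoshidaWindowGramTailJFactoredScaled
import Literature.NumberTheory.LFunctions.YoshidaWindowGramTailMSFactored
import Literature.NumberTheory.LFunctions.YoshidaWindowGramTailJDiagTight
import Summits.RiemannHypothesis.RiemannHypothesis.Theorems.FormatCPsdBands
import Summits.RiemannHypothesis.RiemannHypothesis.Theorems.WeilFormatCDiagShift
import HarnessLib
import Summits.RiemannHypothesis.RiemannHypothesis.Theorems.WeilFormatCDataO97OddAsmB

/-!
# Format C kernel rung `O97` (a = 9729/10000, column-band layout): ASSEMBLY of the flat layout, part C of 6 (ladders of ColSlice13, Front, Mid, CBOddCols0, CBOddCols1; split of the 1601-line assembly at block boundaries by prover B g19 for the 400-line cap; blocks byte-identical): every propositional ladder of the kernel files (table/column validity, front door, sines, middle moments, column data, tail factors, Schur rows, (P) + diagonal shift), byte-identical statements and proofs, original order (A g22 restage_flat.py; weil-2 KERNEL-CHAIN-RULES #1)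

Window `a = 9729/10000`; prime powers in the window: 2, 3, 2^2, 5; prime constant A = 1825/1000 (`WeilFormatC.primeCoeff_form_ge_cells_09729`); evaluator parameters S = 2^256, Kpi 130, Kser 150, kred 8, Kexp 45, J 120; full table modes < 193; light column table modes < 1027; units 2^-250 (Schur entries), 2^-124 (column digits, width 127), 2^-118 (tail-factor digits, width 121), 2^-64 (reciprocal weights), 2^-40 (tail base); order-J tail J = 4, θ = 1/2048, η = 1/10 | 4/1.
Design row: sr-gb-rung-b odd λ-run (parity cell 11 L-side): a = 9729/10000, μ = 2^-81, odd 192/384/1024, MS tail; see HOME(A)/LADDER-LSIDES-FORMATC-A-g22.md and HOME(B)/NOTES-B-g19.md. Generated by sr-gb-rung-a prover A g22 with rh-explicit-weil-2 gen7's generator extended for the odd λ-run (--sector odd --mu-log2; HOME(A)/code-g22/gen7/gramgen7.py sha16 172ee47dc0b1c923) from `#eval` of the tree's `Encl` functions; every datum is re-verified by the kernel in the theorem files (`decide +kernel`). Helper data of the rh-explicit Weil-positivity programme (format C, K-CELL-2), RH-free. [cite: Yoshida1992HermitianForms, §5 (5.15)-(5.16) p. 301; §7 pp. 305–312]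
-/

set_option linter.dupNamespace false
set_option maxRecDepth 200000

-- ===== from WeilFormatCDataO97ColSlice13 =====
namespace Summit.RiemannHypothesis.RiemannHypothesis.Theorems.WeilFormatCData.O97
open Literature.NumberTheory.LFunctions Literature.NumberTheory.LFunctions.Yoshida1992 Encl Literature.Analysis.ValidatedNumerics.NumericsMP

/-- the light column table is valid on `[192, 1027)`. -/
theorem ctab_valid : TabColValid (2 ^ 256) O97.a O97.ks 192 1027 O97.ctab := by
  have h192 : TabColValid (2 ^ 256) a ks 192 192 ctab := TabColValid.empty
  have h202 : TabColValid (2 ^ 256) a ks 192 (192 + 10) ctab :=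
    h192.extend fun m hm hmk ↦ colValid_of_checkTableCol (prm := prm) (by norm_num [prm]) a_pos consts_valid tC192 hm hmk
  have h212 : TabColValid (2 ^ 256) a ks 192 (202 + 10) ctab :=
    h202.extend fun m hm hmk ↦ colValid_of_checkTableCol (prm := prm) (by norm_num [prm]) a_pos consts_valid tC202 hm hmk
  have h222 : TabColValid (2 ^ 256) a ks 192 (212 + 10) ctab :=
    h212.extend fun m hm hmk ↦ colValid_of_checkTableCol (prm := prm) (by norm_num [prm]) a_pos consts_valid tC212 hm hmk
  have h232 : TabColValid (2 ^ 256) a ks 192 (222 + 10) ctab :=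
    h222.extend fun m hm hmk ↦ colValid_of_checkTableCol (prm := prm) (by norm_num [prm]) a_pos consts_valid tC222 hm hmk
  have h242 : TabColValid (2 ^ 256) a ks 192 (232 + 10) ctab :=
    h232.extend fun m hm hmk ↦ colValid_of_checkTableCol (prm := prm) (by norm_num [prm]) a_pos consts_valid tC232 hm hmk
  have h252 : TabColValid (2 ^ 256) a ks 192 (242 + 10) ctab :=
    h242.extend fun m hm hmk ↦ colValid_of_checkTableCol (prm := prm) (by norm_num [prm]) a_pos consts_valid tC242 hm hmk
  have h262 : TabColValid (2 ^ 256) a ks 192 (252 + 10) ctab :=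
    h252.extend fun m hm hmk ↦ colValid_of_checkTableCol (prm := prm) (by norm_num [prm]) a_pos consts_valid tC252 hm hmk
  have h272 : TabColValid (2 ^ 256) a ks 192 (262 + 10) ctab :=
    h262.extend fun m hm hmk ↦ colValid_of_checkTableCol (prm := prm) (by norm_num [prm]) a_pos consts_valid tC262 hm hmk
  have h282 : TabColValid (2 ^ 256) a ks 192 (272 + 10) ctab :=
    h272.extend fun m hm hmk ↦ colValid_of_checkTableCol (prm := prm) (by norm_num [prm]) a_pos consts_valid tC272 hm hmk
  have h292 : TabColValid (2 ^ 256) a ks 192 (282 + 10) ctab :=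
    h282.extend fun m hm hmk ↦ colValid_of_checkTableCol (prm := prm) (by norm_num [prm]) a_pos consts_valid tC282 hm hmk
  have h302 : TabColValid (2 ^ 256) a ks 192 (292 + 10) ctab :=
    h292.extend fun m hm hmk ↦ colValid_of_checkTableCol (prm := prm) (by norm_num [prm]) a_pos consts_valid tC292 hm hmk
  have h312 : TabColValid (2 ^ 256) a ks 192 (302 + 10) ctab :=
    h302.extend fun m hm hmk ↦ colValid_of_checkTableCol (prm := prm) (by norm_num [prm]) a_pos consts_valid tC302 hm hmk
  have h322 : TabColValid (2 ^ 256) a ks 192 (312 + 10) ctab :=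
    h312.extend fun m hm hmk ↦ colValid_of_checkTableCol (prm := prm) (by norm_num [prm]) a_pos consts_valid tC312 hm hmk
  have h332 : TabColValid (2 ^ 256) a ks 192 (322 + 10) ctab :=
    h322.extend fun m hm hmk ↦ colValid_of_checkTableCol (prm := prm) (by norm_num [prm]) a_pos consts_valid tC322 hm hmk
  have h342 : TabColValid (2 ^ 256) a ks 192 (332 + 10) ctab :=
    h332.extend fun m hm hmk ↦ colValid_of_checkTableCol (prm := prm) (by norm_num [prm]) a_pos consts_valid tC332 hm hmk
  have h352 : TabColValid (2 ^ 256) a ks 192 (342 + 10) ctab :=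
    h342.extend fun m hm hmk ↦ colValid_of_checkTableCol (prm := prm) (by norm_num [prm]) a_pos consts_valid tC342 hm hmk
  have h362 : TabColValid (2 ^ 256) a ks 192 (352 + 10) ctab :=
    h352.extend fun m hm hmk ↦ colValid_of_checkTableCol (prm := prm) (by norm_num [prm]) a_pos consts_valid tC352 hm hmk
  have h372 : TabColValid (2 ^ 256) a ks 192 (362 + 10) ctab :=
    h362.extend fun m hm hmk ↦ colValid_of_checkTableCol (prm := prm) (by norm_num [prm]) a_pos consts_valid tC362 hm hmk
  have h382 : TabColValid (2 ^ 256) a ks 192 (372 + 10) ctab :=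
    h372.extend fun m hm hmk ↦ colValid_of_checkTableCol (prm := prm) (by norm_num [prm]) a_pos consts_valid tC372 hm hmk
  have h392 : TabColValid (2 ^ 256) a ks 192 (382 + 10) ctab :=
    h382.extend fun m hm hmk ↦ colValid_of_checkTableCol (prm := prm) (by norm_num [prm]) a_pos consts_valid tC382 hm hmk
  have h402 : TabColValid (2 ^ 256) a ks 192 (392 + 10) ctab :=
    h392.extend fun m hm hmk ↦ colValid_of_checkTableCol (prm := prm) (by norm_num [prm]) a_pos consts_valid tC392 hm hmk
  have h412 : TabColValid (2 ^ 256) a ks 192 (402 + 10) ctab :=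
    h402.extend fun m hm hmk ↦ colValid_of_checkTableCol (prm := prm) (by norm_num [prm]) a_pos consts_valid tC402 hm hmk
  have h422 : TabColValid (2 ^ 256) a ks 192 (412 + 10) ctab :=
    h412.extend fun m hm hmk ↦ colValid_of_checkTableCol (prm := prm) (by norm_num [prm]) a_pos consts_valid tC412 hm hmk
  have h432 : TabColValid (2 ^ 256) a ks 192 (422 + 10) ctab :=
    h422.extend fun m hm hmk ↦ colValid_of_checkTableCol (prm := prm) (by norm_num [prm]) a_pos consts_valid tC422 hm hmk
  have h442 : TabColValid (2 ^ 256) a ks 192 (432 + 10) ctab :=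
    h432.extend fun m hm hmk ↦ colValid_of_checkTableCol (prm := prm) (by norm_num [prm]) a_pos consts_valid tC432 hm hmk
  have h452 : TabColValid (2 ^ 256) a ks 192 (442 + 10) ctab :=
    h442.extend fun m hm hmk ↦ colValid_of_checkTableCol (prm := prm) (by norm_num [prm]) a_pos consts_valid tC442 hm hmk
  have h462 : TabColValid (2 ^ 256) a ks 192 (452 + 10) ctab :=
    h452.extend fun m hm hmk ↦ colValid_of_checkTableCol (prm := prm) (by norm_num [prm]) a_pos consts_valid tC452 hm hmk
  have h472 : TabColValid (2 ^ 256) a ks 192 (462 + 10) ctab :=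
    h462.extend fun m hm hmk ↦ colValid_of_checkTableCol (prm := prm) (by norm_num [prm]) a_pos consts_valid tC462 hm hmk
  have h482 : TabColValid (2 ^ 256) a ks 192 (472 + 10) ctab :=
    h472.extend fun m hm hmk ↦ colValid_of_checkTableCol (prm := prm) (by norm_num [prm]) a_pos consts_valid tC472 hm hmk
  have h492 : TabColValid (2 ^ 256) a ks 192 (482 + 10) ctab :=
    h482.extend fun m hm hmk ↦ colValid_of_checkTableCol (prm := prm) (by norm_num [prm]) a_pos consts_valid tC482 hm hmk
  have h502 : TabColValid (2 ^ 256) a ks 192 (492 + 10) ctab :=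
    h492.extend fun m hm hmk ↦ colValid_of_checkTableCol (prm := prm) (by norm_num [prm]) a_pos consts_valid tC492 hm hmk
  have h512 : TabColValid (2 ^ 256) a ks 192 (502 + 10) ctab :=
    h502.extend fun m hm hmk ↦ colValid_of_checkTableCol (prm := prm) (by norm_num [prm]) a_pos consts_valid tC502 hm hmk
  have h522 : TabColValid (2 ^ 256) a ks 192 (512 + 10) ctab :=
    h512.extend fun m hm hmk ↦ colValid_of_checkTableCol (prm := prm) (by norm_num [prm]) a_pos consts_valid tC512 hm hmk
  have h532 : TabColValid (2 ^ 256) a ks 192 (522 + 10) ctab :=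
    h522.extend fun m hm hmk ↦ colValid_of_checkTableCol (prm := prm) (by norm_num [prm]) a_pos consts_valid tC522 hm hmk
  have h542 : TabColValid (2 ^ 256) a ks 192 (532 + 10) ctab :=
    h532.extend fun m hm hmk ↦ colValid_of_checkTableCol (prm := prm) (by norm_num [prm]) a_pos consts_valid tC532 hm hmk
  have h552 : TabColValid (2 ^ 256) a ks 192 (542 + 10) ctab :=
    h542.extend fun m hm hmk ↦ colValid_of_checkTableCol (prm := prm) (by norm_num [prm]) a_pos consts_valid tC542 hm hmk
  have h562 : TabColValid (2 ^ 256) a ks 192 (552 + 10) ctab :=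
    h552.extend fun m hm hmk ↦ colValid_of_checkTableCol (prm := prm) (by norm_num [prm]) a_pos consts_valid tC552 hm hmk
  have h572 : TabColValid (2 ^ 256) a ks 192 (562 + 10) ctab :=
    h562.extend fun m hm hmk ↦ colValid_of_checkTableCol (prm := prm) (by norm_num [prm]) a_pos consts_valid tC562 hm hmk
  have h582 : TabColValid (2 ^ 256) a ks 192 (572 + 10) ctab :=
    h572.extend fun m hm hmk ↦ colValid_of_checkTableCol (prm := prm) (by norm_num [prm]) a_pos consts_valid tC572 hm hmk
  have h592 : TabColValid (2 ^ 256) a ks 192 (582 + 10) ctab :=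
    h582.extend fun m hm hmk ↦ colValid_of_checkTableCol (prm := prm) (by norm_num [prm]) a_pos consts_valid tC582 hm hmk
  have h602 : TabColValid (2 ^ 256) a ks 192 (592 + 10) ctab :=
    h592.extend fun m hm hmk ↦ colValid_of_checkTableCol (prm := prm) (by norm_num [prm]) a_pos consts_valid tC592 hm hmk
  have h612 : TabColValid (2 ^ 256) a ks 192 (602 + 10) ctab :=
    h602.extend fun m hm hmk ↦ colValid_of_checkTableCol (prm := prm) (by norm_num [prm]) a_pos consts_valid tC602 hm hmk
  have h622 : TabColValid (2 ^ 256) a ks 192 (612 + 10) ctab :=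
    h612.extend fun m hm hmk ↦ colValid_of_checkTableCol (prm := prm) (by norm_num [prm]) a_pos consts_valid (not_not.mp tC612b) hm hmk
  have h632 : TabColValid (2 ^ 256) a ks 192 (622 + 10) ctab :=
    h622.extend fun m hm hmk ↦ colValid_of_checkTableCol (prm := prm) (by norm_num [prm]) a_pos consts_valid (not_not.mp tC622b) hm hmk
  have h642 : TabColValid (2 ^ 256) a ks 192 (632 + 10) ctab :=
    h632.extend fun m hm hmk ↦ colValid_of_checkTableCol (prm := prm) (by norm_num [prm]) a_pos consts_valid (not_not.mp tC632b) hm hmk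
  have h652 : TabColValid (2 ^ 256) a ks 192 (642 + 10) ctab :=
    h642.extend fun m hm hmk ↦ colValid_of_checkTableCol (prm := prm) (by norm_num [prm]) a_pos consts_valid (not_not.mp tC642b) hm hmk
  have h662 : TabColValid (2 ^ 256) a ks 192 (652 + 10) ctab :=
    h652.extend fun m hm hmk ↦ colValid_of_checkTableCol (prm := prm) (by norm_num [prm]) a_pos consts_valid (not_not.mp tC652b) hm hmk
  have h672 : TabColValid (2 ^ 256) a ks 192 (662 + 10) ctab :=
    h662.extend fun m hm hmk ↦ colValid_of_checkTableCol (prm := prm) (by norm_num [prm]) a_pos consts_valid (not_not.mp tC662b) hm hmk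
  have h682 : TabColValid (2 ^ 256) a ks 192 (672 + 10) ctab :=
    h672.extend fun m hm hmk ↦ colValid_of_checkTableCol (prm := prm) (by norm_num [prm]) a_pos consts_valid tC672 hm hmk
  have h692 : TabColValid (2 ^ 256) a ks 192 (682 + 10) ctab :=
    h682.extend fun m hm hmk ↦ colValid_of_checkTableCol (prm := prm) (by norm_num [prm]) a_pos consts_valid tC682 hm hmk
  have h702 : TabColValid (2 ^ 256) a ks 192 (692 + 10) ctab :=
    h692.extend fun m hm hmk ↦ colValid_of_checkTableCol (prm := prm) (by norm_num [prm]) a_pos consts_valid tC692 hm hmk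
  have h712 : TabColValid (2 ^ 256) a ks 192 (702 + 10) ctab :=
    h702.extend fun m hm hmk ↦ colValid_of_checkTableCol (prm := prm) (by norm_num [prm]) a_pos consts_valid tC702 hm hmk
  have h722 : TabColValid (2 ^ 256) a ks 192 (712 + 10) ctab :=
    h712.extend fun m hm hmk ↦ colValid_of_checkTableCol (prm := prm) (by norm_num [prm]) a_pos consts_valid tC712 hm hmk
  have h732 : TabColValid (2 ^ 256) a ks 192 (722 + 10) ctab :=
    h722.extend fun m hm hmk ↦ colValid_of_checkTableCol (prm := prm) (by norm_num [prm]) a_pos consts_valid tC722 hm hmk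
  have h742 : TabColValid (2 ^ 256) a ks 192 (732 + 10) ctab :=
    h732.extend fun m hm hmk ↦ colValid_of_checkTableCol (prm := prm) (by norm_num [prm]) a_pos consts_valid (not_not.mp tC732b) hm hmk
  have h752 : TabColValid (2 ^ 256) a ks 192 (742 + 10) ctab :=
    h742.extend fun m hm hmk ↦ colValid_of_checkTableCol (prm := prm) (by norm_num [prm]) a_pos consts_valid (not_not.mp tC742b) hm hmk
  have h762 : TabColValid (2 ^ 256) a ks 192 (752 + 10) ctab :=
    h752.extend fun m hm hmk ↦ colValid_of_checkTableCol (prm := prm) (by norm_num [prm]) a_pos consts_valid (not_not.mp tC752b) hm hmk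
  have h772 : TabColValid (2 ^ 256) a ks 192 (762 + 10) ctab :=
    h762.extend fun m hm hmk ↦ colValid_of_checkTableCol (prm := prm) (by norm_num [prm]) a_pos consts_valid (not_not.mp tC762b) hm hmk
  have h782 : TabColValid (2 ^ 256) a ks 192 (772 + 10) ctab :=
    h772.extend fun m hm hmk ↦ colValid_of_checkTableCol (prm := prm) (by norm_num [prm]) a_pos consts_valid (not_not.mp tC772b) hm hmk
  have h792 : TabColValid (2 ^ 256) a ks 192 (782 + 10) ctab :=
    h782.extend fun m hm hmk ↦ colValid_of_checkTableCol (prm := prm) (by norm_num [prm]) a_pos consts_valid (not_not.mp tC782b) hm hmk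
  have h802 : TabColValid (2 ^ 256) a ks 192 (792 + 10) ctab :=
    h792.extend fun m hm hmk ↦ colValid_of_checkTableCol (prm := prm) (by norm_num [prm]) a_pos consts_valid (not_not.mp tC792b) hm hmk
  have h812 : TabColValid (2 ^ 256) a ks 192 (802 + 10) ctab :=
    h802.extend fun m hm hmk ↦ colValid_of_checkTableCol (prm := prm) (by norm_num [prm]) a_pos consts_valid (not_not.mp tC802b) hm hmk
  have h822 : TabColValid (2 ^ 256) a ks 192 (812 + 10) ctab :=
    h812.extend fun m hm hmk ↦ colValid_of_checkTableCol (prm := prm) (by norm_num [prm]) a_pos consts_valid (not_not.mp tC812b) hm hmk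
  have h832 : TabColValid (2 ^ 256) a ks 192 (822 + 10) ctab :=
    h822.extend fun m hm hmk ↦ colValid_of_checkTableCol (prm := prm) (by norm_num [prm]) a_pos consts_valid (not_not.mp tC822b) hm hmk
  have h842 : TabColValid (2 ^ 256) a ks 192 (832 + 10) ctab :=
    h832.extend fun m hm hmk ↦ colValid_of_checkTableCol (prm := prm) (by norm_num [prm]) a_pos consts_valid (not_not.mp tC832b) hm hmk
  have h852 : TabColValid (2 ^ 256) a ks 192 (842 + 10) ctab :=
    h842.extend fun m hm hmk ↦ colValid_of_checkTableCol (prm := prm) (by norm_num [prm]) a_pos consts_valid (not_not.mp tC842b) hm hmk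
  have h862 : TabColValid (2 ^ 256) a ks 192 (852 + 10) ctab :=
    h852.extend fun m hm hmk ↦ colValid_of_checkTableCol (prm := prm) (by norm_num [prm]) a_pos consts_valid (not_not.mp tC852b) hm hmk
  have h872 : TabColValid (2 ^ 256) a ks 192 (862 + 10) ctab :=
    h862.extend fun m hm hmk ↦ colValid_of_checkTableCol (prm := prm) (by norm_num [prm]) a_pos consts_valid (not_not.mp tC862b) hm hmk
  have h882 : TabColValid (2 ^ 256) a ks 192 (872 + 10) ctab :=
    h872.extend fun m hm hmk ↦ colValid_of_checkTableCol (prm := prm) (by norm_num [prm]) a_pos consts_valid (not_not.mp tC872b) hm hmk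
  have h892 : TabColValid (2 ^ 256) a ks 192 (882 + 10) ctab :=
    h882.extend fun m hm hmk ↦ colValid_of_checkTableCol (prm := prm) (by norm_num [prm]) a_pos consts_valid (not_not.mp tC882b) hm hmk
  have h902 : TabColValid (2 ^ 256) a ks 192 (892 + 10) ctab :=
    h892.extend fun m hm hmk ↦ colValid_of_checkTableCol (prm := prm) (by norm_num [prm]) a_pos consts_valid (not_not.mp tC892b) hm hmk
  have h912 : TabColValid (2 ^ 256) a ks 192 (902 + 10) ctab :=
    h902.extend fun m hm hmk ↦ colValid_of_checkTableCol (prm := prm) (by norm_num [prm]) a_pos consts_valid (not_not.mp tC902b) hm hmk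
  have h922 : TabColValid (2 ^ 256) a ks 192 (912 + 10) ctab :=
    h912.extend fun m hm hmk ↦ colValid_of_checkTableCol (prm := prm) (by norm_num [prm]) a_pos consts_valid (not_not.mp tC912b) hm hmk
  have h932 : TabColValid (2 ^ 256) a ks 192 (922 + 10) ctab :=
    h922.extend fun m hm hmk ↦ colValid_of_checkTableCol (prm := prm) (by norm_num [prm]) a_pos consts_valid (not_not.mp tC922b) hm hmk
  have h942 : TabColValid (2 ^ 256) a ks 192 (932 + 10) ctab :=
    h932.extend fun m hm hmk ↦ colValid_of_checkTableCol (prm := prm) (by norm_num [prm]) a_pos consts_valid (not_not.mp tC932b) hm hmk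
  have h952 : TabColValid (2 ^ 256) a ks 192 (942 + 10) ctab :=
    h942.extend fun m hm hmk ↦ colValid_of_checkTableCol (prm := prm) (by norm_num [prm]) a_pos consts_valid (not_not.mp tC942b) hm hmk
  have h962 : TabColValid (2 ^ 256) a ks 192 (952 + 10) ctab :=
    h952.extend fun m hm hmk ↦ colValid_of_checkTableCol (prm := prm) (by norm_num [prm]) a_pos consts_valid (not_not.mp tC952b) hm hmk
  have h972 : TabColValid (2 ^ 256) a ks 192 (962 + 10) ctab :=
    h962.extend fun m hm hmk ↦ colValid_of_checkTableCol (prm := prm) (by norm_num [prm]) a_pos consts_valid (not_not.mp tC962b) hm hmk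
  have h982 : TabColValid (2 ^ 256) a ks 192 (972 + 10) ctab :=
    h972.extend fun m hm hmk ↦ colValid_of_checkTableCol (prm := prm) (by norm_num [prm]) a_pos consts_valid (not_not.mp tC972b) hm hmk
  have h992 : TabColValid (2 ^ 256) a ks 192 (982 + 10) ctab :=
    h982.extend fun m hm hmk ↦ colValid_of_checkTableCol (prm := prm) (by norm_num [prm]) a_pos consts_valid (not_not.mp tC982b) hm hmk
  have h1002 : TabColValid (2 ^ 256) a ks 192 (992 + 10) ctab :=
    h992.extend fun m hm hmk ↦ colValid_of_checkTableCol (prm := prm) (by norm_num [prm]) a_pos consts_valid (not_not.mp tC992b) hm hmk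
  have h1012 : TabColValid (2 ^ 256) a ks 192 (1002 + 10) ctab :=
    h1002.extend fun m hm hmk ↦ colValid_of_checkTableCol (prm := prm) (by norm_num [prm]) a_pos consts_valid (not_not.mp tC1002b) hm hmk
  have h1022 : TabColValid (2 ^ 256) a ks 192 (1012 + 10) ctab :=
    h1012.extend fun m hm hmk ↦ colValid_of_checkTableCol (prm := prm) (by norm_num [prm]) a_pos consts_valid (not_not.mp tC1012b) hm hmk
  have h1027 : TabColValid (2 ^ 256) a ks 192 (1022 + 5) ctab :=
    h1022.extend fun m hm hmk ↦ colValid_of_checkTableCol (prm := prm) (by norm_num [prm]) a_pos consts_valid (not_not.mp tC1022b) hm hmk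
  exact h1027

end Summit.RiemannHypothesis.RiemannHypothesis.Theorems.WeilFormatCData.O97

-- ===== from WeilFormatCDataO97Front =====
namespace Summit.RiemannHypothesis.RiemannHypothesis.Theorems.WeilFormatCData.O97
open Literature.NumberTheory.LFunctions Literature.NumberTheory.LFunctions.Yoshida1992 Encl Literature.Analysis.ValidatedNumerics.NumericsMP

/-- odd column range (kit form). -/
theorem ctab_valid_odd : TabColValid (2 ^ 256) O97.a O97.ks 192 (1024 + 2) O97.ctab :=
  fun m hm hmk ↦ ctab_valid m (by omega) (by omega)

/-- odd column range (column-data form). -/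
theorem ctab_valid_oddK : TabColValid (2 ^ 256) O97.a O97.ks 192 (192 + 192 + 1) O97.ctab :=
  fun m hm hmk ↦ ctab_valid m (by omega) (by omega)

/-- the front-door constants are valid for `a`. -/
theorem fd_valid : FDValid (2 ^ 256) O97.a O97.F :=
  fdValid_of_check (prm := prm) (ks := ks) (by norm_num [prm]) primeData consts_valid (not_not.mp tFb)

/-- `FA` is valid with the certified prime constant `A = 1825/1000` plus the margin μ = 2^-81. -/
theorem fdA_valid : FDValidA (2 ^ 256) O97.a (((22062896207966982438387717 : ℤ) : ℝ) / (12089258196146291747061760 : ℕ)) O97.FA :=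
  fd_valid.withFrac 22062896207966982438387717 (by norm_num)

/-- λ-run: `FA` is valid with `A + 2·lam`, `lam = lamZ·2^-250`, `lamZ = 374144419156711147060143317175368453031918731001856` (the shape the odd λ-door reads). -/
theorem fdA_valid_shift : FDValidA (2 ^ 256) O97.a (((1825 : ℤ) : ℝ) / (1000 : ℕ) + 2 * ((((2 ^ 168 : ℤ) : ℤ) : ℝ) * (1 / 2 ^ 250))) O97.FA := by
  convert fdA_valid using 2
  push_cast
  norm_num

/-- kernel (assembled from the eight bands of 104, `WeilFormatCData.A1.wvBands_range_of_bands4`): odd reciprocal column weights against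
the arctan far diagonal, all 832 columns, square-root minorants `O97CBOdd.rsW / 1099512676352`, weights unpacked once (`(not_not.mp vw_eq_vwLb)`). -/
theorem tWvO : checkWeightsOddV (2 ^ 256) 150 O97.C O97.FA O97.ctab 192 832 64 O97CBOdd.vw O97CBOdd.rsW 1099512676352 214041 1048576 = true := by
  rw [show checkWeightsOddV (2 ^ 256) 150 O97.C O97.FA O97.ctab 192 832 64 O97CBOdd.vw O97CBOdd.rsW 1099512676352 214041 1048576
      = (List.range 832).all (fun t ↦ decide (0 < O97CBOdd.vw.getD t 0) && checkSqrtLower 192 (192 + t + 1) (O97CBOdd.rsW.getD t 0) 1099512676352 && match devOddABox (2 ^ 256) 150 O97.C O97.FA (tget O97.ctab (192 + t + 1)) (192 + t) 192 (O97CBOdd.rsW.getD t 0) 1099512676352 214041 1048576 with | some Y => decide ((2 ^ 64 : ℤ) * ((2 ^ 256 : ℕ) : ℤ) ≤ (O97CBOdd.vw.getD t 0 : ℤ) * Y.lo) | none => false) from rfl, (not_not.mp vw_eq_vwLb)]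
  exact WeilFormatCData.A1.wvBands_range_of_bands4 (a := 208) (b := 208) (c := 208) (d := 208)
    (S2FormatC.E0.band_append (n₀ := 0) (k := 104) (k' := 104) (not_not.mp tWvOb0b) (not_not.mp tWvOb104b))
    (S2FormatC.E0.band_append (n₀ := 208) (k := 104) (k' := 104) (not_not.mp tWvOb208b) (not_not.mp tWvOb312b))
    (S2FormatC.E0.band_append (n₀ := 416) (k := 104) (k' := 104) (not_not.mp tWvOb416b) (not_not.mp tWvOb520b))
    (S2FormatC.E0.band_append (n₀ := 624) (k := 104) (k' := 104) (not_not.mp tWvOb624b) (not_not.mp tWvOb728b))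

/-- the mean-square tail's sine hypotheses for `s = sFun sd1 csd`, `sFun2 sdm csd`, `sFun2 sdp csd` (window written out once). -/
theorem sines :
    (∀ k ∈ weilPrimeIndex O97.a, IsPrimePow k → 0 ≤ sFun O97.sd1 O97.csd k ∧ sFun O97.sd1 O97.csd k ≤ |Real.sin (Real.pi * Real.log k / (((9729 : ℤ) : ℝ) / (10000 : ℕ)) / 2)|) ∧
    (∀ k ∈ weilPrimeIndex O97.a, ∀ k' ∈ weilPrimeIndex O97.a, IsPrimePow k → IsPrimePow k' → k ≠ k' →
      0 ≤ sFun2 O97.sdm O97.csd k k' ∧ sFun2 O97.sdm O97.csd k k' ≤ |Real.sin ((Real.pi * Real.log k / O97.a - Real.pi * Real.log k' / O97.a) / 2)|) ∧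
    (∀ k ∈ weilPrimeIndex O97.a, ∀ k' ∈ weilPrimeIndex O97.a, IsPrimePow k → IsPrimePow k' →
      0 ≤ sFun2 O97.sdp O97.csd k k' ∧ sFun2 O97.sdp O97.csd k k' ≤ |Real.sin ((Real.pi * Real.log k / O97.a + Real.pi * Real.log k' / O97.a) / 2)|) :=
  sines_of_check (prm := prm) (by norm_num [prm]) primeData consts_valid (not_not.mp tSinesb)

end Summit.RiemannHypothesis.RiemannHypothesis.Theorems.WeilFormatCData.O97

-- ===== from WeilFormatCDataO97Mid =====
namespace Summit.RiemannHypothesis.RiemannHypothesis.Theorems.WeilFormatCData.O97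
open Literature.NumberTheory.LFunctions Literature.NumberTheory.LFunctions.Yoshida1992 Encl Literature.Analysis.ValidatedNumerics.NumericsMP

/-- the odd middle moment record is valid (light table on the middle range; `B₄` as a literal). -/
theorem momO_valid : MidMomValidO (2 ^ 256) O97.a (wvF (O97CBOdd.vw.drop 192) 64 384) 384 1024 4 O97.momO := by
  have h : MidMomValidO (2 ^ 256) a (wvF (O97CBOdd.vw.drop 192) 64 384) 384 (384 + 640) 4 (midMomO (2 ^ 256) C ctab 64 (O97CBOdd.vw.drop 192) 384 640 4) :=
    midMomO_valid (S := 2 ^ 256) (by norm_num) primeData consts_valid (fun m hm hmk ↦ ctab_valid m (by omega) (by omega)) 4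
  rw [show (384 + 640 : ℕ) = 1024 from rfl] at h
  exact ⟨fun j hj j' hj' ↦ by rw [tMomO_AA]; exact h.AA j hj j' hj', fun j hj r hr ↦ by rw [tMomO_AB]; exact h.AB j hj r hr,
    fun r hr j hj ↦ by rw [tMomO_BA]; exact h.BA r hr j hj, fun r hr r' hr' ↦ by rw [tMomO_BB]; exact h.BB r hr r' hr', by rw [tMomO_sm]; exact h.sm⟩

end Summit.RiemannHypothesis.RiemannHypothesis.Theorems.WeilFormatCData.O97

-- ===== from WeilFormatCDataO97CBOddCols0 =====
namespace Summit.RiemannHypothesis.RiemannHypothesis.Theorems.WeilFormatCData.O97CBOdd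
open Literature.NumberTheory.LFunctions Literature.NumberTheory.LFunctions.Yoshida1992 Encl Literature.Analysis.ValidatedNumerics.NumericsMP
open Summit.RiemannHypothesis.RiemannHypothesis.Theorems.WeilFormatCData.O97

/-- column data certified below row `28`. -/
theorem colData28 : DataNear (fun i t ↦ sectorKernel true (gramCoeff O97.a) i (192 + t)) 28 192 127 (2 ^ (127 - 1)) 124 O97CBOdd.ρc O97CBOdd.XP := by
  have hT := tab_valid_odd
  have hCT := ctab_valid_oddK
  have h0 : DataNear (fun i t ↦ sectorKernel true (gramCoeff a) i (192 + t)) 0 192 127 (2 ^ (127 - 1)) 124 ρc XP := DataNear.zeroRows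
  have h4 : DataNear (fun i t ↦ sectorKernel true (gramCoeff a) i (192 + t)) (0 + 4) 192 127 (2 ^ (127 - 1)) 124 ρc XP :=
    colDataNear_extendRows (S := 2 ^ 256) (by norm_num) a_pos primeData consts_valid (by norm_num : 1 ≤ 192) hT hCT true (by norm_num) rfl h0 tCol0
  have h8 : DataNear (fun i t ↦ sectorKernel true (gramCoeff a) i (192 + t)) (4 + 4) 192 127 (2 ^ (127 - 1)) 124 ρc XP :=
    colDataNear_extendRows (S := 2 ^ 256) (by norm_num) a_pos primeData consts_valid (by norm_num : 1 ≤ 192) hT hCT true (by norm_num) rfl h4 tCol4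
  have h12 : DataNear (fun i t ↦ sectorKernel true (gramCoeff a) i (192 + t)) (8 + 4) 192 127 (2 ^ (127 - 1)) 124 ρc XP :=
    colDataNear_extendRows (S := 2 ^ 256) (by norm_num) a_pos primeData consts_valid (by norm_num : 1 ≤ 192) hT hCT true (by norm_num) rfl h8 tCol8
  have h16 : DataNear (fun i t ↦ sectorKernel true (gramCoeff a) i (192 + t)) (12 + 4) 192 127 (2 ^ (127 - 1)) 124 ρc XP :=
    colDataNear_extendRows (S := 2 ^ 256) (by norm_num) a_pos primeData consts_valid (by norm_num : 1 ≤ 192) hT hCT true (by norm_num) rfl h12 tCol12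
  have h20 : DataNear (fun i t ↦ sectorKernel true (gramCoeff a) i (192 + t)) (16 + 4) 192 127 (2 ^ (127 - 1)) 124 ρc XP :=
    colDataNear_extendRows (S := 2 ^ 256) (by norm_num) a_pos primeData consts_valid (by norm_num : 1 ≤ 192) hT hCT true (by norm_num) rfl h16 tCol16
  have h24 : DataNear (fun i t ↦ sectorKernel true (gramCoeff a) i (192 + t)) (20 + 4) 192 127 (2 ^ (127 - 1)) 124 ρc XP :=
    colDataNear_extendRows (S := 2 ^ 256) (by norm_num) a_pos primeData consts_valid (by norm_num : 1 ≤ 192) hT hCT true (by norm_num) rfl h20 tCol20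
  have h28 : DataNear (fun i t ↦ sectorKernel true (gramCoeff a) i (192 + t)) (24 + 4) 192 127 (2 ^ (127 - 1)) 124 ρc XP :=
    colDataNear_extendRows (S := 2 ^ 256) (by norm_num) a_pos primeData consts_valid (by norm_num : 1 ≤ 192) hT hCT true (by norm_num) rfl h24 tCol24
  exact h28

end Summit.RiemannHypothesis.RiemannHypothesis.Theorems.WeilFormatCData.O97CBOdd

-- ===== from WeilFormatCDataO97CBOddCols1 =====
namespace Summit.RiemannHypothesis.RiemannHypothesis.Theorems.WeilFormatCData.O97CBOdd
open Literature.NumberTheory.LFunctions Literature.NumberTheory.LFunctions.Yoshida1992 Encl Literature.Analysis.ValidatedNumerics.NumericsMP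
open Summit.RiemannHypothesis.RiemannHypothesis.Theorems.WeilFormatCData.O97

/-- column data certified below row `56`. -/
theorem colData56 : DataNear (fun i t ↦ sectorKernel true (gramCoeff O97.a) i (192 + t)) 56 192 127 (2 ^ (127 - 1)) 124 O97CBOdd.ρc O97CBOdd.XP := by
  have hT := tab_valid_odd
  have hCT := ctab_valid_oddK
  have h28 := colData28
  have h32 : DataNear (fun i t ↦ sectorKernel true (gramCoeff a) i (192 + t)) (28 + 4) 192 127 (2 ^ (127 - 1)) 124 ρc XP :=
    colDataNear_extendRows (S := 2 ^ 256) (by norm_num) a_pos primeData consts_valid (by norm_num : 1 ≤ 192) hT hCT true (by norm_num) rfl h28 tCol28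
  have h36 : DataNear (fun i t ↦ sectorKernel true (gramCoeff a) i (192 + t)) (32 + 4) 192 127 (2 ^ (127 - 1)) 124 ρc XP :=
    colDataNear_extendRows (S := 2 ^ 256) (by norm_num) a_pos primeData consts_valid (by norm_num : 1 ≤ 192) hT hCT true (by norm_num) rfl h32 tCol32
  have h40 : DataNear (fun i t ↦ sectorKernel true (gramCoeff a) i (192 + t)) (36 + 4) 192 127 (2 ^ (127 - 1)) 124 ρc XP :=
    colDataNear_extendRows (S := 2 ^ 256) (by norm_num) a_pos primeData consts_valid (by norm_num : 1 ≤ 192) hT hCT true (by norm_num) rfl h36 tCol36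
  have h44 : DataNear (fun i t ↦ sectorKernel true (gramCoeff a) i (192 + t)) (40 + 4) 192 127 (2 ^ (127 - 1)) 124 ρc XP :=
    colDataNear_extendRows (S := 2 ^ 256) (by norm_num) a_pos primeData consts_valid (by norm_num : 1 ≤ 192) hT hCT true (by norm_num) rfl h40 tCol40
  have h48 : DataNear (fun i t ↦ sectorKernel true (gramCoeff a) i (192 + t)) (44 + 4) 192 127 (2 ^ (127 - 1)) 124 ρc XP :=
    colDataNear_extendRows (S := 2 ^ 256) (by norm_num) a_pos primeData consts_valid (by norm_num : 1 ≤ 192) hT hCT true (by norm_num) rfl h44 tCol44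
  have h52 : DataNear (fun i t ↦ sectorKernel true (gramCoeff a) i (192 + t)) (48 + 4) 192 127 (2 ^ (127 - 1)) 124 ρc XP :=
    colDataNear_extendRows (S := 2 ^ 256) (by norm_num) a_pos primeData consts_valid (by norm_num : 1 ≤ 192) hT hCT true (by norm_num) rfl h48 tCol48
  have h56 : DataNear (fun i t ↦ sectorKernel true (gramCoeff a) i (192 + t)) (52 + 4) 192 127 (2 ^ (127 - 1)) 124 ρc XP :=
    colDataNear_extendRows (S := 2 ^ 256) (by norm_num) a_pos primeData consts_valid (by norm_num : 1 ≤ 192) hT hCT true (by norm_num) rfl h52 tCol52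
  exact h56

end Summit.RiemannHypothesis.RiemannHypothesis.Theorems.WeilFormatCData.O97CBOdd
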